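import Summits.ResolutionOfSingularities.ResolutionOfSingularities.Theorems.PurelyInseparableDim4SwapTransportReadTwo
import Summits.ResolutionOfSingularities.ResolutionOfSingularities.Theorems.PurelyInseparableDim4ResConeCInfGameStep
import HarnessLib
import HarnessLib.Audit.Tags

/-!
# Purely inseparable four-folds — WINDOW GLUE for the rotating C∞ case: which slot a real step leaves, read from the weights,
# and the shape of a translation pinned by (VT) (cell `res-dim4-pi`, K2(p) lane, slice B; K24b-R1)

[OURS · counted 0 · cell `res-dim4-pi` · K2(p) lane holder's ruling 2026-08-29 04:33:16Z (K24b-R1 (b), res-dim4-typ-1 g3); glue for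
the virtual window (`pub/res-dim4/res-dim4-typ-1/lean-g3/K24b-R1-WINDOW-SKELETON.lean`).]  Nothing here proves K2(p)/K2(5),
`NoIsolatedTrap 5 5` or resolution of singularities in dimension ≥ 4 / characteristic `p` — NOT proved.  AI kernel work, weaker
than expert review.

* §1 **`step_cases_of_weights`** — on the light `d = 4` tail (boundary of two weight-1 letters `x, y`, order `6`, `p = 5`), a
  step whose child again has weights `≤ 1` of total `2` is one of: a SLOT step in chart `x` keeping `y` (`b y = 0`), a slot step
  in chart `y` keeping `x`, or a ROTATION: chart `∉ {x, y}`, exactly one of `x, y` kept and the other translated away — with the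
  child's ledger written out in each case (res-dim4-p-7 g3's `SwapNorm.step_r_apply`).
* §2 `eq_single_of_letters` — a translation vanishing on three of the four letters is `Pi.single` of the fourth (the shape
  res-dim4-p-2 g4's (VT-u) consumes after (VT-f) and the slot readings).
bears_on: LADDER-RESOLUTION:D157-DOOR2 (res-dim4-pi · K2(p) · slice B · K24b-R1).  Supports
stmt-ResolutionOfSingularities-16155 (helper).
-/

set_option linter.dupNamespace false -- mandated namespace of this single-conjunct summit

noncomputable section

namespace Summit.ResolutionOfSingularities.ResolutionOfSingularities.Theorems.PIDim4

namespace SwapTransport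

open MvPolynomial Finset
open Literature.AlgebraicGeometry.Resolution
open Literature.AlgebraicGeometry.Resolution.CentreBlowup
open Literature.AlgebraicGeometry.Resolution.Hauser2010

variable {K : Type} [Field K] [DecidableEq K]

/-! ## §1 Which slot a step leaves -/

/-- The weights of the child of a light `d = 4` state, letter by letter: the chart letter gets `1`, a translated letter `0`,
the others keep their weight. [folklore] [cite: Hauser2010, §F (transform D')] -/
theorem step_r_apply_six {A : State K} (ho : ordZero A.F = 6) (jr : Fin 4) (b : Fin 4 → K) (i : Fin 4) :
    (CentreBlowup.step 5 Finset.univ jr b A).r i = if i = jr then 1 else if b i = 0 then A.r i else 0 := by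
  rw [SwapNorm.step_r_apply, ordAlong_univ, ho]
  rfl

/-- **WHICH SLOT A STEP LEAVES** (K24b-R1 window glue).  `A` has ledger `x_x x_y` (two weight-1 letters among the four distinct
letters `x, y, v, w`), order `6`; a step in chart `jr` with translation `b` (`b jr = 0`) whose child has weights `≤ 1` of total
weight `2` is: (slot `x`) `jr = x`, `b y = 0`, child ledger `x_x x_y`; or (slot `y`) symmetrically; or (rotation through `jr ∈ {v, w}`)
exactly one of `x, y` is kept and the child ledger is `x_{jr}·x_{kept}`. [OURS] [cite: Hauser2010, §F] -/
theorem step_cases_of_weights {x y v w : Fin 4} (hxy : x ≠ y) (hxv : x ≠ v) (hxw : x ≠ w) (hyv : y ≠ v) (hyw : y ≠ w)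
    (hvw : v ≠ w) {A : State K} (hrA : A.r = Finsupp.single x 1 + Finsupp.single y 1) (ho : ordZero A.F = 6)
    {jr : Fin 4} {b : Fin 4 → K} (hw1 : ∀ i, (CentreBlowup.step 5 Finset.univ jr b A).r i ≤ 1)
    (hdeg : (CentreBlowup.step 5 Finset.univ jr b A).r.degree = 2) :
    (jr = x ∧ b y = 0 ∧ (CentreBlowup.step 5 Finset.univ jr b A).r = Finsupp.single x 1 + Finsupp.single y 1) ∨
    (jr = y ∧ b x = 0 ∧ (CentreBlowup.step 5 Finset.univ jr b A).r = Finsupp.single x 1 + Finsupp.single y 1) ∨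
    ((jr = v ∨ jr = w) ∧
      ((b x ≠ 0 ∧ b y = 0 ∧ (CentreBlowup.step 5 Finset.univ jr b A).r = Finsupp.single jr 1 + Finsupp.single y 1) ∨
       (b y ≠ 0 ∧ b x = 0 ∧ (CentreBlowup.step 5 Finset.univ jr b A).r = Finsupp.single jr 1 + Finsupp.single x 1))) := by
  have _ := hw1
  set r' := (CentreBlowup.step 5 Finset.univ jr b A).r with hr'
  have hval : ∀ i, r' i = if i = jr then 1 else if b i = 0 then A.r i else 0 := fun i => by
    rw [hr']; exact step_r_apply_six ho jr b i
  obtain ⟨hAx, hAy, hAv, hAw⟩ := ResCone.quad_apply hxy hxv hxw hyv hyw hvw 1 1 0 0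
  have hrA' : A.r = Finsupp.single x 1 + Finsupp.single y 1 + Finsupp.single v 0 + Finsupp.single w 0 := by
    rw [hrA, Finsupp.single_zero, Finsupp.single_zero, add_zero, add_zero]
  rw [← hrA'] at hAx hAy hAv hAw
  have hsum : r'.degree = r' x + r' y + r' v + r' w := ResCone.degree_eq_quad hxy hxv hxw hyv hyw hvw r'
  rw [hdeg] at hsum
  -- `r'` as a four-letter sum
  have hr'eq : r' = Finsupp.single x (r' x) + Finsupp.single y (r' y) + Finsupp.single v (r' v) + Finsupp.single w (r' w) :=
    ResCone.eq_sum_single_four hxy hxv hxw hyv hyw hvw r'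
  have hrx := hval x
  have hry := hval y
  have hrv := hval v
  have hrw := hval w
  rw [hAx] at hrx
  rw [hAy] at hry
  rw [hAv, ite_self] at hrv
  rw [hAw, ite_self] at hrw
  rcases ResCone.letters_exhaust hxy hxv hxw hyv hyw hvw jr with h | h | h | h
  · -- slot `x`
    subst h
    refine Or.inl ⟨rfl, ?_, ?_⟩
    · by_contra hby
      rw [if_pos rfl] at hrx
      rw [if_neg (Ne.symm hxy), if_neg hby] at hry
      rw [if_neg (Ne.symm hxv)] at hrv
      rw [if_neg (Ne.symm hxw)] at hrw
      omega
    · have hby : b y = 0 := by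
        by_contra hby
        rw [if_pos rfl] at hrx
        rw [if_neg (Ne.symm hxy), if_neg hby] at hry
        rw [if_neg (Ne.symm hxv)] at hrv
        rw [if_neg (Ne.symm hxw)] at hrw
        omega
      rw [if_pos rfl] at hrx
      rw [if_neg (Ne.symm hxy), if_pos hby] at hry
      rw [if_neg (Ne.symm hxv)] at hrv
      rw [if_neg (Ne.symm hxw)] at hrw
      rw [hr'eq, hrx, hry, hrv, hrw, Finsupp.single_zero, Finsupp.single_zero, add_zero, add_zero]
  · -- slot `y`
    subst h
    refine Or.inr (Or.inl ⟨rfl, ?_, ?_⟩)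
    · by_contra hbx
      rw [if_neg hxy, if_neg hbx] at hrx
      rw [if_pos rfl] at hry
      rw [if_neg (Ne.symm hyv)] at hrv
      rw [if_neg (Ne.symm hyw)] at hrw
      omega
    · have hbx : b x = 0 := by
        by_contra hbx
        rw [if_neg hxy, if_neg hbx] at hrx
        rw [if_pos rfl] at hry
        rw [if_neg (Ne.symm hyv)] at hrv
        rw [if_neg (Ne.symm hyw)] at hrw
        omega
      rw [if_neg hxy, if_pos hbx] at hrx
      rw [if_pos rfl] at hry
      rw [if_neg (Ne.symm hyv)] at hrv
      rw [if_neg (Ne.symm hyw)] at hrw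
      rw [hr'eq, hrx, hry, hrv, hrw, Finsupp.single_zero, Finsupp.single_zero, add_zero, add_zero]
  · -- rotation through `v`
    subst h
    refine Or.inr (Or.inr ⟨Or.inl rfl, ?_⟩)
    rw [if_neg hxv] at hrx
    rw [if_neg hyv] at hry
    rw [if_pos rfl] at hrv
    rw [if_neg (Ne.symm hvw)] at hrw
    by_cases hbx : b x = 0
    · rw [if_pos hbx] at hrx
      have hby : b y ≠ 0 := by
        intro hby; rw [if_pos hby] at hry; omega
      rw [if_neg hby] at hry
      refine Or.inr ⟨hby, hbx, ?_⟩
      rw [hr'eq, hrx, hry, hrv, hrw, Finsupp.single_zero, Finsupp.single_zero, add_zero, add_zero, add_comm]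
    · rw [if_neg hbx] at hrx
      have hby : b y = 0 := by
        by_contra hby; rw [if_neg hby] at hry; omega
      rw [if_pos hby] at hry
      refine Or.inl ⟨hbx, hby, ?_⟩
      rw [hr'eq, hrx, hry, hrv, hrw, Finsupp.single_zero, Finsupp.single_zero, zero_add, add_zero, add_comm]
  · -- rotation through `w`
    subst h
    refine Or.inr (Or.inr ⟨Or.inr rfl, ?_⟩)
    rw [if_neg hxw] at hrx
    rw [if_neg hyw] at hry
    rw [if_neg hvw] at hrv
    rw [if_pos rfl] at hrw
    by_cases hbx : b x = 0
    · rw [if_pos hbx] at hrx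
      have hby : b y ≠ 0 := by
        intro hby; rw [if_pos hby] at hry; omega
      rw [if_neg hby] at hry
      refine Or.inr ⟨hby, hbx, ?_⟩
      rw [hr'eq, hrx, hry, hrv, hrw, Finsupp.single_zero, Finsupp.single_zero, add_zero, add_zero, add_comm]
    · rw [if_neg hbx] at hrx
      have hby : b y = 0 := by
        by_contra hby; rw [if_neg hby] at hry; omega
      rw [if_pos hby] at hry
      refine Or.inl ⟨hbx, hby, ?_⟩
      rw [hr'eq, hrx, hry, hrv, hrw, Finsupp.single_zero, Finsupp.single_zero, zero_add, add_zero, add_comm]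

/-! ## §2 The shape of a pinned translation -/

omit [DecidableEq K] in
/-- A translation vanishing on three of four distinct letters is `Pi.single` of the fourth. [folklore] -/
theorem eq_single_of_letters {x y v w : Fin 4} (hxy : x ≠ y) (hxv : x ≠ v) (hxw : x ≠ w) (hyv : y ≠ v) (hyw : y ≠ w)
    (hvw : v ≠ w) {b : Fin 4 → K} (hx : b x = 0) (hy : b y = 0) (hw : b w = 0) : b = Pi.single v (b v) := by
  funext i
  rcases ResCone.letters_exhaust hxy hxv hxw hyv hyw hvw i with h | h | h | h <;> rw [h]
  · rw [hx, Pi.single_eq_of_ne hxv]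
  · rw [hy, Pi.single_eq_of_ne hyv]
  · rw [Pi.single_eq_same]
  · rw [hw, Pi.single_eq_of_ne (Ne.symm hvw)]

end SwapTransport

end Summit.ResolutionOfSingularities.ResolutionOfSingularities.Theorems.PIDim4

end
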